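import Mathlib
import Summits.BirchSwinnertonDyer.BirchSwinnertonDyer.Theorems.CyclotomicUntwistPrimePowerGaussSum

/-!
# STUB-IDEAS `stub_heegnerIndexLowerAtTwo` — ideator k = 2, generation 19 (planner, stub-ideation)

Crux `PrintCf2.SplitBadTwoLowerHalfOfFacts` (stmt-BirchSwinnertonDyer-27851), registered child skeleton
`HeegnerIndexTwo` (sha f2bd84c0…), stub `stub_heegnerIndexLowerAtTwo`. TECHNIQUE: literature transfer with a
typed dictionary (menu family 1). Companion card: `Ideas/stub-heegnerindexloweratwo-k2-g19.md`.

HONEST FRAMING: nothing here proves BSD, the crux, or the stub. This file is Mathlib + ONE tree Theorems file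
(`CyclotomicUntwistPrimePowerGaussSum`, p-adic-valued prime-power Gauss sums, already landed for another route) and
contains TWO `sorry`s — the helper signatures `norm_gaussSum_inv_eq_norm_gaussSum_dyadic` (H1-iso, the Galois-isometry
step; the only one the p = 2 chain uses) and `norm_gaussSum_primePow_of_two_le` (H1-gen, the all-`p` print theorem,
cite-shaped) — everything else is kernel-checked.

WHAT IT TYPES (STUB-PLAN v4.0 ORDER NOW item **R136′ = `γ₁`**, the last booked column of `e_A = α + (1 − γ₁)·n_v`):
* §A  THE DYADIC GAUSS NORM: every Gauss sum of a PRIMITIVE character mod `2^c` (`c ≥ 1`) against a primitive additive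
  character has `‖g‖_{ℂ₂} = 2^{−c/2}` EXACTLY (`norm_gaussSum_dyadic`, from the tree's product formula
  `PSPrimePowerGauss.gaussSum_mul_gaussSum_inv_eq` + H1-iso). In print with the explicit root of unity:
  [arXiv:1410.6179, Thm. 2.1] (`G(χ,2^m) = 2^{m/2}·(root of unity)`, all `m ≥ 2`). The p = 2 miracle used by H1-iso:
  `(ℤ/2^c)ˣ` is a 2-group, so ALL values of `η` lie in `μ_{2^∞}` and `σ_{−1} ∈ Gal(ℚ₂(μ_{2^∞})/ℚ₂)` — an isometry —
  maps `g(η,ψ) ↦ g(η⁻¹,ψ⁻¹)` (false shape for odd p: Stickelberger).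
* §A′ the three quadratic instances at the twin's own point (`n_v = 2, 3`: `2i`, `2√2`, `2i√2`), sorry-free.
* §B  de Shalit II.4.14 (36)–(37) bookkeeping: the like-Gauss-sum `G(ε) = φ^kφ̄^j(𝔭ⁿ)/pⁿ · Σ_{γ∈S} χ(γ)ζ_n^{−γ}` is the
  ONLY Gauss factor (𝔭-component only; 𝔭̄-ramification enters (36) through the removed Euler factors of
  `L_{∞,𝔤𝔭̄}` and the conductor), so `2·v_𝔭 G(ε) = (2k − 1)·n`; at type (1,0): `+n` in e-currency, i.e. `γ₁ = 1`,
  hence `e_A` KEY-FREE (`eA_keyFree_of_gammaOne`).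
* §C  Disegni 2017 Def. 4 / Thm. A: in the RAMIFIED case the interpolation factor IS a Gauss sum,
  `Z_w(χ'_w) = τ(χ'_w·α_v∘q, ψ)` — non-zero (tree: `gaussSum_ne_zero_of_isPrimitive`) and of size `2^{−n_v/2}` (§A):
  the K13 audit line «no exceptional zero at v ∣ 2» of FALLBACK 1″ is discharged BY RAMIFICATION for all six keys.

References: [deShalit1987, II.4.11 (29)–(30) Remark (i), II.4.12 (31), II.4.14 (36)–(37)];
[arXiv:1410.6179, Thm. 2.1]; [Disegni2017 = arXiv:1510.02114, Def. 2, Def. 4, Thm. A (Z_w), Thm. B];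
[BurungaleFlach2024 = arXiv:2206.09874, Thm. 1.1].
-/

noncomputable section

open scoped Classical

set_option linter.dupNamespace false
set_option autoImplicit false

namespace Summit.BirchSwinnertonDyer.BirchSwinnertonDyer.Cruxes.SplitBadTwoLowerHalfOfFacts.StubIdeasK2G19

open Summit.BirchSwinnertonDyer.BirchSwinnertonDyer.Theorems

/-! ### §A The dyadic Gauss norm: `‖g(η, ψ)‖_{ℂ₂} = 2^{−c/2}` for EVERY primitive `η` mod `2^c` -/

/-- `‖2‖ = 1/2` in `ℂ₂`. -/
theorem norm_two_padicComplex : ‖(2 : ℂ_[2])‖ = 2⁻¹ := by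
  have h2 : (algebraMap ℚ_[2] ℂ_[2]) 2 = 2 := map_ofNat _ 2
  have hp : ‖(2 : ℚ_[2])‖ = 2⁻¹ := by
    have := Padic.norm_p (p := 2)
    simpa using this
  rw [← h2, norm_algebraMap', hp]

/-- `‖2^c‖ = 2^{-c}` in `ℂ₂`, written with `(2⁻¹)^c`. -/
theorem norm_two_pow_padicComplex (c : ℕ) : ‖((2 ^ c : ℕ) : ℂ_[2])‖ = (2⁻¹ : ℝ) ^ c := by
  rw [Nat.cast_pow, norm_pow]
  simp [norm_two_padicComplex]

/-- Real-exponent bookkeeping: `(2^{−c/2})² = (1/2)^c`. -/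
theorem rpow_neg_half_sq (c : ℕ) : ((2 : ℝ) ^ (-(c : ℝ) / 2)) ^ 2 = (2⁻¹ : ℝ) ^ c := by
  rw [← Real.rpow_natCast ((2 : ℝ) ^ (-(c : ℝ) / 2)) 2, ← Real.rpow_mul (by norm_num : (0 : ℝ) ≤ 2)]
  rw [show (-(c : ℝ) / 2 * ((2 : ℕ) : ℝ)) = -(c : ℝ) by push_cast; ring]
  rw [Real.rpow_neg (by norm_num : (0 : ℝ) ≤ 2), Real.rpow_natCast, inv_pow]

/-- **H1-core (PROVED).** For a primitive `η` mod `2^c` (`c ≥ 1`) and a primitive additive `ψ`, IF the two Gauss sums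
`g(η,ψ)` and `g(η⁻¹,ψ⁻¹)` have the same `ℂ₂`-norm, then `‖g(η,ψ)‖ = 2^{−c/2}`: the tree's product formula
`g(η,ψ)·g(η⁻¹,ψ⁻¹) = 2^c` (`PSPrimePowerGauss.gaussSum_mul_gaussSum_inv_eq`) and `‖2^c‖ = 2^{−c}`.
[folklore; arXiv:1410.6179 Thm. 2.1 for the explicit value] -/
theorem norm_gaussSum_dyadic_of_norm_eq {c : ℕ} (hc : 0 < c) (η : DirichletCharacter ℂ_[2] (2 ^ c))
    (hη : η.IsPrimitive) {ψ : AddChar (ZMod (2 ^ c)) ℂ_[2]} (hψ : ψ.IsPrimitive)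
    (hiso : ‖gaussSum η⁻¹ ψ⁻¹‖ = ‖gaussSum η ψ‖) :
    ‖gaussSum η ψ‖ = (2 : ℝ) ^ (-(c : ℝ) / 2) := by
  have hprod := PSPrimePowerGauss.gaussSum_mul_gaussSum_inv_eq (p := 2) η hc hη hψ
  have hnorm : ‖gaussSum η ψ‖ ^ 2 = (2⁻¹ : ℝ) ^ c := by
    have h := congrArg (fun x : ℂ_[2] ↦ ‖x‖) hprod
    simp only [norm_mul, hiso, ZMod.card] at h
    rw [norm_two_pow_padicComplex] at h
    rw [sq]; exact h
  rw [← rpow_neg_half_sq] at hnorm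
  exact (pow_left_inj₀ (norm_nonneg _) (by positivity) two_ne_zero).mp hnorm

/-- **H1-iso (helper SIGNATURE — `sorry` no. 1 of 2 in this file; the p = 2 chain needs only this one).** At `p = 2`
the Gauss sums `g(η,ψ)` and `g(η⁻¹,ψ⁻¹)` have the same `ℂ₂`-norm. THREE PROOF ROUTES (size S on paper, M in Lean):
(a) GALOIS ISOMETRY: `(ℤ/2^c)ˣ` is a 2-GROUP, so every value of `η` and of `ψ` lies in `μ_{2^∞} ⊂ L := ℚ₂(μ_{2^c}) ⊂ ℂ₂`;
the automorphism `σ_{−1} : ζ ↦ ζ⁻¹` of `L/ℚ₂` sends `g(η,ψ) = Σ η(a)ψ(a)` to `Σ η(a)⁻¹ψ(−a) = g(η⁻¹,ψ⁻¹)`, and Galois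
automorphisms of a finite extension of `ℚ₂` are ISOMETRIES (uniqueness of the norm extension; Mathlib
`spectralNorm_eq_of_equiv` + `spectralNorm_unique_of_finiteDimensional_normal`). (b) KRONECKER: 2 is totally ramified in `ℚ(ζ_{2^c})` and its prime is conjugation-stable, so
`g/ḡ` has absolute value 1 at every place, hence is a root of unity: `g² ∈ μ·η(−1)·2^c`. (c) STATIONARY PHASE = the
explicit evaluation IN PRINT [arXiv:1410.6179, Thm. 2.1]: for EVERY prime `p` and every PRIMITIVE `χ` mod `p^m` with
`m ≥ 2`, `G(χ,p^m) = p^{m/2}·u` with `u` an explicit root of unity (`χ(α)e_{p^m}(α)(−2rc/p)^m ε_{p^m}` for odd `p`;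
`(2/c)^m ω^c`, `ω = e^{πi/4}`, for `p = 2`, `m ≥ 5`; `i`, `ω^{1−χ(−1)}`, `χ(−c)e_{16}(−c)` for `m = 2, 3, 4`) — so the
exact half-valuation is a WILD-CONDUCTOR phenomenon (`m ≥ 2`, any `p`); only the TAME case `m = 1`, odd `p`, has the
Stickelberger fractional valuations; at `p = 2` every primitive conductor is `2^m` with `m ≥ 2`, i.e. there is NO tame
exception — which is why the statement below needs no hypothesis beyond primitivity. -/
theorem norm_gaussSum_inv_eq_norm_gaussSum_dyadic {c : ℕ} (hc : 0 < c)
    (η : DirichletCharacter ℂ_[2] (2 ^ c)) (hη : η.IsPrimitive)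
    {ψ : AddChar (ZMod (2 ^ c)) ℂ_[2]} (hψ : ψ.IsPrimitive) :
    ‖gaussSum η⁻¹ ψ⁻¹‖ = ‖gaussSum η ψ‖ := by
  sorry

/-- **H1 — THE DYADIC GAUSS NORM.** `‖g(η,ψ)‖_{ℂ₂} = 2^{−c/2}` for every primitive `η` mod `2^c`, `c ≥ 1`, and
primitive `ψ` (modulo H1-iso). This is the number that the by-hand ledgers book as «Gauss digit `ord₂ = n_v/2`»
(STUB-PLAN B-list) — here for ALL characters of the dyadic tower, not only the quadratic ones, which is what the
B24♯ net-`t` test needs along the tower. [arXiv:1410.6179, Thm. 2.1] -/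
theorem norm_gaussSum_dyadic {c : ℕ} (hc : 0 < c) (η : DirichletCharacter ℂ_[2] (2 ^ c))
    (hη : η.IsPrimitive) {ψ : AddChar (ZMod (2 ^ c)) ℂ_[2]} (hψ : ψ.IsPrimitive) :
    ‖gaussSum η ψ‖ = (2 : ℝ) ^ (-(c : ℝ) / 2) :=
  norm_gaussSum_dyadic_of_norm_eq hc η hη hψ (norm_gaussSum_inv_eq_norm_gaussSum_dyadic hc η hη hψ)

/-- In `2·ord₂` («e»)-currency: `‖g‖ = 2^{−m/2}` with the INTEGER `m = c` — the slope of the Gauss digit in the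
conductor exponent is exactly `1` (`γ₁ = 1`), with no character-dependent unit. -/
theorem norm_gaussSum_dyadic_eCurrency {c : ℕ} (hc : 0 < c) (η : DirichletCharacter ℂ_[2] (2 ^ c))
    (hη : η.IsPrimitive) {ψ : AddChar (ZMod (2 ^ c)) ℂ_[2]} (hψ : ψ.IsPrimitive) :
    ∃ m : ℤ, ‖gaussSum η ψ‖ = (2 : ℝ) ^ (-(m : ℝ) / 2) ∧ m = c :=
  ⟨c, by simpa using norm_gaussSum_dyadic hc η hη hψ, rfl⟩

/-- **H1-gen (helper SIGNATURE — `sorry` no. 2 of 2; cite-shaped, NOT used by the p = 2 chain).** The print theorem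
behind H1 for EVERY prime: a primitive Gauss sum to a WILD prime-power modulus `p^c`, `c ≥ 2`, has `‖g‖_{ℂ_p} =
p^{−c/2}` exactly. [arXiv:1410.6179, Thm. 2.1 (Cochrane–Zheng method); variations: Odoni 1973, Mauclaire] — recorded
because the same digit appears in every additive-reduction residual class at odd `p` (conductor exponent `≥ 2`). -/
theorem norm_gaussSum_primePow_of_two_le {p : ℕ} [Fact p.Prime] {c : ℕ} (hc : 2 ≤ c)
    (η : DirichletCharacter ℂ_[p] (p ^ c)) (hη : η.IsPrimitive)
    {ψ : AddChar (ZMod (p ^ c)) ℂ_[p]} (hψ : ψ.IsPrimitive) :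
    ‖gaussSum η ψ‖ = (p : ℝ) ^ (-(c : ℝ) / 2) := by
  sorry

/-! ### §A′ The twin's own point: the three quadratic dyadic Gauss sums `2i`, `2√2`, `2i√2` (sorry-free) -/

/-- `‖i‖ = 1` for any square root of `−1` in `ℂ₂`. -/
theorem norm_eq_one_of_sq_eq_neg_one (i : ℂ_[2]) (hi : i ^ 2 = -1) : ‖i‖ = 1 := by
  have h : ‖i‖ ^ 2 = 1 ^ 2 := by rw [← norm_pow, hi]; simp
  exact (pow_left_inj₀ (norm_nonneg _) zero_le_one two_ne_zero).mp h

/-- `‖√2‖² = 1/2` for any square root of `2` in `ℂ₂`. -/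
theorem norm_sq_of_sq_eq_two (s : ℂ_[2]) (hs : s ^ 2 = 2) : ‖s‖ ^ 2 = 2⁻¹ := by
  rw [← norm_pow, hs, norm_two_padicComplex]

/-- Conductor `4` (`d ≡ 3 (4)`, keys `(1,3), (1,7)`): `τ(χ_{−4}) = 2i` [arXiv:1410.6179 Thm. 2.1, `m = 2`], and
`‖2i‖ = 2^{−2/2}`. -/
theorem norm_gauss_conductor_four (i : ℂ_[2]) (hi : i ^ 2 = -1) :
    ‖(2 : ℂ_[2]) * i‖ = (2 : ℝ) ^ (-(2 : ℝ) / 2) := by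
  rw [norm_mul, norm_two_padicComplex, norm_eq_one_of_sq_eq_neg_one i hi, mul_one]
  rw [show (-(2 : ℝ) / 2) = -1 by norm_num, Real.rpow_neg_one]

/-- Conductor `8`, even character (`χ_8`; `d ≡ 2 (8)`-type keys): `τ(χ_8) = 2√2`, `‖2√2‖ = 2^{−3/2}`.
[arXiv:1410.6179 Thm. 2.1, `m = 3`, `χ(−1) = 1`] -/
theorem norm_gauss_conductor_eight_even (s : ℂ_[2]) (hs : s ^ 2 = 2) :
    ‖(2 : ℂ_[2]) * s‖ = (2 : ℝ) ^ (-(3 : ℝ) / 2) := by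
  have h : ‖(2 : ℂ_[2]) * s‖ ^ 2 = ((2 : ℝ) ^ (-(3 : ℝ) / 2)) ^ 2 := by
    rw [norm_mul, mul_pow, norm_sq_of_sq_eq_two s hs, norm_two_padicComplex]
    have := rpow_neg_half_sq 3
    push_cast at this
    rw [this]; norm_num
  exact (pow_left_inj₀ (norm_nonneg _) (by positivity) two_ne_zero).mp h

/-- Conductor `8`, odd character (`χ_{−8}`): `τ(χ_{−8}) = 2i√2`, `‖2i√2‖ = 2^{−3/2}`.
[arXiv:1410.6179 Thm. 2.1, `m = 3`, `χ(−1) = −1`] -/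
theorem norm_gauss_conductor_eight_odd (i s : ℂ_[2]) (hi : i ^ 2 = -1) (hs : s ^ 2 = 2) :
    ‖(2 : ℂ_[2]) * i * s‖ = (2 : ℝ) ^ (-(3 : ℝ) / 2) := by
  rw [mul_assoc, mul_left_comm, norm_mul, norm_eq_one_of_sq_eq_neg_one i hi, one_mul]
  exact norm_gauss_conductor_eight_even s hs

/-! ### §B de Shalit II.4.14 (36)–(37): ONE like-Gauss-sum, `𝔭`-component only ⟹ `γ₁ = 1`, `e_A` key-free -/

/-- **The (37) ledger.** In `2·ord_𝔭`-currency write `vφ2 = 2·ord_𝔭 φ^kφ̄^j(𝔭ⁿ) = 2kn` (`(φ(𝔭ⁿ)) = 𝔭ⁿ`,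
`(φ̄(𝔭ⁿ)) = 𝔭̄ⁿ`, class number one), `2·ord_𝔭 pⁿ = 2n`, `vτ2 = 2·ord_𝔭 Σ_{γ∈S}χ(γ)ζ_n^{−γ} = n` (§A: a primitive
Gauss sum mod `2ⁿ` times the root of unity `χ(γ₀)`); then `2·ord_𝔭 G(ε) = (2k − 1)·n`.
[deShalit1987, II.4.14 (37); II.4.11 Remark (i): `G(ε) = 1` if `ε` unramified at `𝔭`, `G(ε)Ḡ(ε) = p^{n(k−1)}`] -/
theorem deShalit37_twoOrd_G (k n vφ2 vp2 vτ2 vG2 : ℤ) (hφ : vφ2 = 2 * k * n) (hp : vp2 = 2 * n)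
    (hτ : vτ2 = n) (hG : vG2 = vφ2 - vp2 + vτ2) : vG2 = (2 * k - 1) * n := by
  subst hφ hp hτ; rw [hG]; ring

/-- At the twin's in-range type `(1,0)` (`k = 1`): ONE Gauss digit `+n` in e-currency — the R136′ answer «one, not
two» (no Gauss factor at `𝔭̄` in (36): `𝔭̄`-ramification only removes Euler factors in `L_{∞,𝔤𝔭̄}`), i.e. `γ₁ = 1`.
Consistency with de Shalit's `G(ε)Ḡ(ε) = p^{n(k−1)} = 1`: `ord_𝔭 G = n/2 = −ord_𝔭̄ G`. [deShalit1987, II.4.14 (36)–(37)] -/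
theorem deShalit37_twoOrd_G_typeOneZero (n vG2 : ℤ) (hG : vG2 = 2 * 1 * n - 2 * n + n) : vG2 = n := by
  rw [hG]; ring

/-- **R136′ ⟹ `e_A` KEY-FREE.** Row 53's ledger `e_A(key) = α + (1 − γ₁)·n_v(key)` with `γ₁ = 1` is constant in
the key. (The intercept `α` is then fixed by ONE anchor of any key — §3 (ix) of the STUB-PLAN, in-tree `d = −1`.) -/
theorem eA_keyFree_of_gammaOne (α γ₁ : ℤ) (nv eA : ℤ × ℤ → ℤ)
    (h : ∀ key, eA key = α + (1 - γ₁) * nv key) (hγ : γ₁ = 1) : ∀ key key', eA key = eA key' := by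
  intro key key'; rw [h, h, hγ]; ring

/-- The B24♯ net-`t` oracle with the KNOWN Gauss line removed: along the dyadic tower the Gauss digit at depth `t`
is EXACTLY `(2k−1)·t` (§A–§B), so a comparison constant of the shape `a + b·2^t + ((2k−1) + c)·t − (2k−1)·t` is
eventually constant iff `b = c = 0` — stated here in the minimal form the critic runs: a function that is both
eventually constant and of the form `a + c·t` has `c = 0`. -/
theorem netT_slope_zero (a c : ℤ) (T : ℕ) (h : ∀ t : ℕ, T ≤ t → a + c * (t : ℤ) = a + c * ((t : ℤ) + 1)) : c = 0 := by
  have := h T le_rfl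
  linarith

/-! ### §C Disegni 2017 at `v ∣ 2`: the RAMIFIED interpolation factor is a Gauss sum — non-zero, size `2^{−n_v/2}` -/

/-- **K13 line «no exceptional zero at v ∣ 2» — discharged by ramification.** Disegni 2017 Def. 4: `χ_w` is NOT
exceptional iff `Z_w(χ_w) ≠ 0`; Thm. A's factor in the case `χ'_w·α_v∘q_w` RAMIFIED is the Gauss sum
`τ(χ'_w·α_v∘q, ψ_{E_w})` [arXiv:1510.02114, display after Thm. A; Def. 2, Def. 4]. For `W = W₀ ⊗ χ_e`
(`e ∈ {−1, ±2}`) the unit character is `α_v = χ_{e,2}·μ` (ramified, conductor `2^{n_v}`), `E_w = ℚ₂` (2 split in the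
Heegner field), `χ' = 𝟙`: the factor is a primitive dyadic Gauss sum, hence NON-ZERO — the tree's
`PSPrimePowerGauss.gaussSum_ne_zero_of_isPrimitive` — and of norm `2^{−n_v/2}` (§A). -/
theorem disegni_Zw_ramified_ne_zero_and_norm {c : ℕ} (hc : 0 < c) (α : DirichletCharacter ℂ_[2] (2 ^ c))
    (hα : α.IsPrimitive) {ψ : AddChar (ZMod (2 ^ c)) ℂ_[2]} (hψ : ψ.IsPrimitive) :
    gaussSum α ψ ≠ 0 ∧ ‖gaussSum α ψ‖ = (2 : ℝ) ^ (-(c : ℝ) / 2) :=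
  ⟨PSPrimePowerGauss.gaussSum_ne_zero_of_isPrimitive (p := 2) α hc hα hψ, norm_gaussSum_dyadic hc α hα hψ⟩

end Summit.BirchSwinnertonDyer.BirchSwinnertonDyer.Cruxes.SplitBadTwoLowerHalfOfFacts.StubIdeasK2G19

end
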